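import Summits.BirchSwinnertonDyer.BirchSwinnertonDyer.Theorems.GenusKolyvaginAtTwoPowDvdShaCardAtTwoRTTransverseValueAtFrobSq
import Summits.BirchSwinnertonDyer.BirchSwinnertonDyer.Theorems.GenusKolyvaginAtTwoPowDvdShaCardAtTwoRTBottomRungTransverseReduction
import Summits.BirchSwinnertonDyer.BirchSwinnertonDyer.Theorems.GenusKolyvaginAtTwoPowDvdShaCardAtTwoRTBottomRungSocket
import Summits.BirchSwinnertonDyer.BirchSwinnertonDyer.Theorems.GenusKolyvaginAtTwoEquivariantKolyvaginExactAtTwoLemma53Rat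
import Literature.NumberTheory.EllipticCurves.ArtinFormalismQuadraticLocalProofs
import Literature.NumberTheory.EllipticCurves.HeegnerGeomCoherentDataOfFrameProofs
import HarnessLib

/-!
# Route `GenusKolyvaginAtTwo`, crux L_T `PowDvdShaCardAtTwoRT` (stmt-BirchSwinnertonDyer-23242), LINE 18 stub KS, bottom rung —
# THE (V44)-SOCKET `hTr` DISCHARGED: `hbot_socket_margin` with `hTr` GONE

Seat `bsd-line-gk2-p3` g24 (PROVER seat 3/3, cell `bsd-f1-sign2`), `--supports stmt-BirchSwinnertonDyer-23242` (helper; closes nothing).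
THEOREMS ONLY (no definition, no named fact, no `sorry`).  BSD is NOT proved by any of this; neither is the crux nor stub KS.

WHAT.  The bottom rung of the KS assembly (gk2-p5 g24 `RelaxedCount.hbot_socket_margin`, LEAD's closure
`exists_deep_primitive_of_gross_witness'`) displayed ONE local socket at the deep own primes `ℓ ∣ n′`:
`hTr : … resTorsion W K 4 Z = c₂(n′) → … L ≤ M(ℓ) → FrobEqFrobInfty W K (2^L) ℓ → ∀ 𝔓 ∣ ℓ, ∀ F c₀, F` Frobenius at `𝔓`, `F = c₀` on
`E[4]` `→ ∃ P₁, [2•Z, F] = F•P₁ − P₁`.  This file PROVES it for every `L ≥ 3` (`hTr_of_three_le`) and re-exports gk2-p5's `hbot`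
socket and LEAD's closure without it (`exists_deep_primitive_of_gross_witness_of_three_le`, `hbot_socket_margin_of_three_le`,
`hbot_socket_margin_onHabitat_of_three_le` — extra hypothesis `3 ≤ L` / `3 ≤ L + k`, free in the KS assembly where `L ≥ 12`).
HOW.  LEAD g18's reduction (`…RTBottomRungTransverseReduction`): `hTr` at `(Z, F)` ⟸ `2 • [Z, F·F] = 0` (regular frame of `c₀` on
`E[4]` for `Δ < 0`, `exists_regular_generator_of_Δ_neg`) ⟸ `2 • [res_K Z, τ] = 0` for the `τ ∈ Γ_K` over `F·F` (squares of `Γ_ℚ` lie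
in `res Γ_K`, `sq_mem_range_absGaloisRestrict_of_sq_eq`; `τ` fixes `E_K[4]` since `F² = c₀² = 1` on `E[4]`); and this seat's K-side
theorem `TransverseValue.h1Eval_kolyvaginClass_eq_zero_of_absGaloisRestrict_eq_sq` (§1 below, assembled from
`…RTTransverseValueAtFrobSq`: Howard's Lemma 2.7.3 at `2` read at `τ_{F²}`, which fixes `K[ℓ]` by the dihedral input) gives
`[c₂(n′), τ] = 0` outright — index `≥ 3` at `ℓ` is margin one at level `4`.  The hypothesis `FrobEqFrobInfty W K (2^L) ℓ` of `hTr` is not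
even used (the quantifier supplies `F = c₀` on `E[4]`).

References: [McCallumLMS1991] §4 Prop. 4.4 (1), §5 proof of Prop. 5.2 (13), Lemma 5.3; [Howard2004HeegnerKolyvagin] Lemma 2.7.3;
[GrossLMS1991] §3 (3.3), §9; [Kolyvagin1991MathAnn] Thm. 2.2; [NeukirchANT1999] Ch. I §9.
-/

set_option autoImplicit false
-- the Theorems namespace of this sub repeats the summit name by design (D-0017 nested layout)
set_option linter.dupNamespace false

noncomputable section

open scoped Classical Pointwise

open WeierstrassCurve NumberField IsDedekindDomain Field
open Literature.NumberTheory.EllipticCurves Literature.NumberTheory.GaloisRepresentations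
open Literature.NumberTheory.GaloisCohomology
open Literature.NumberTheory.EllipticCurves.ModularForms
open Summit.BirchSwinnertonDyer.Rank1Residual
open Summit.BirchSwinnertonDyer.BirchSwinnertonDyer.Theses.GenusKolyvaginAtTwo (KolyvaginRelationAtTwo)

namespace Summit.BirchSwinnertonDyer.BirchSwinnertonDyer.Theorems.GenusExact.TransverseValue

section KSide

variable {K : Type} [Field K] [NumberField K] (W : WeierstrassCurve ℚ) [W.IsElliptic] [W.IsGloballyMinimal]
  [NeZero (W.conductorNorm ℤ)]

/-- **§1 THE K-SIDE OF THE (V44)-SOCKET `hTr`: `[c_k(n′), τ_{F²}]_K = 0`.**  `K` imaginary quadratic with `d_K < −4`; `n′` a square-free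
product of Zhang–Kolyvagin primes of index `≥ k`, `d` the tree's datum on `n′`, `ℓ ∣ n′` an own prime of index `≥ k + 1`; `F ∈ Γ_ℚ` an
arithmetic Frobenius at a prime `𝔓` of `\bar ℤ_ℚ` above `ℓ`; `τ ∈ Γ_K` with `res τ = F·F`, fixing `E_K[2^k]`.  Then the value of
Kolyvagin's class at `τ` vanishes: `[c_k(n′), τ]_K = 0`.  Proof: `τ` lies in the decomposition group of the prime `𝔔 = ι 𝔓` of `\bar ℤ_K`
(`comap_decompositionSubgroup_comap_absIntegersMap`), above the place `λ ∋ ℓ` of `K`; `τ` fixes `K[ℓ]` (`smul_algHom_ringClassField_eq_of_absGaloisRestrict_eq_sq`); so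
`h1Eval_kolyvaginClass_eq_zero_of_fixes_ringClassField` applies.
This is the socket `hTrK` of LEAD's `…RTBottomRungTransverseReduction` (via `two_zsmul_h1Eval_sq_eq_zero_of_resTorsion`).
[cite: Howard2004HeegnerKolyvagin, Lemma 2.7.3] [cite: McCallumLMS1991, §5 proof of Prop. 5.2 (13)] [cite: GrossLMS1991, §3, §9] -/
theorem h1Eval_kolyvaginClass_eq_zero_of_absGaloisRestrict_eq_sq (hK : IsImaginaryQuadratic K)
    (hD : NumberField.discr K < -4) (Dt : ModularParametrizationData W (W.conductorNorm ℤ)) (β : ℤ)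
    (ι : K →+* ℂ) [∀ j : ℕ, NumberField (ringClassField K ι j)] (k : ℕ) {c : ℕ} (hc : Squarefree c)
    (hcK : ∀ q ∈ c.primeFactors, Zhang2014.IsKolyvaginPrime (W.conductorNorm ℤ) W K 2 q ∧
      k ≤ Zhang2014.kolyvaginIndex W 2 q)
    (d : KolyvaginHeegnerData Dt β ι c) {ℓ : ℕ} (hℓ : ℓ ∈ c.primeFactors)
    (hkℓ : k + 1 ≤ Zhang2014.kolyvaginIndex W 2 ℓ)
    {v : HeightOneSpectrum (𝓞 ℚ)} (hℓv : (ℓ : 𝓞 ℚ) ∈ v.asIdeal)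
    {𝔓 : Ideal (absIntegers (𝓞 ℚ) ℚ)} (h𝔓 : 𝔓 ∈ v.primesAbove)
    {F : absoluteGaloisGroup ℚ} (hF : IsArithFrobAt (𝓞 ℚ) F 𝔓)
    {τ : absoluteGaloisGroup K} (hτF : absGaloisRestrict ℚ K τ = F * F)
    (hτT : τ ∈ torsionFixing (W.baseChange K) ((2 ^ k : ℕ) : ℤ)) :
    h1Eval (W.baseChange K) ((2 ^ k : ℕ) : ℤ) (d.kolyvaginClass Nat.prime_two k) τ = 0 := by
  haveI : Algebra.IsAlgebraic ℚ K := Algebra.IsAlgebraic.of_finite ℚ K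
  have hℓp : ℓ.Prime := Nat.prime_of_mem_primeFactors hℓ
  have hℓ0 : ℓ ≠ 0 := hℓp.ne_zero
  have hKol := (hcK ℓ hℓ).1
  have hinert : (Ideal.span {(ℓ : 𝓞 K)}).IsPrime := hKol.2.2.2.2.1
  -- the prime `𝔔 = ι 𝔓` of `\bar ℤ_K` and the place `λ ∋ ℓ` of `K` below it
  haveI := h𝔓.1
  obtain ⟨𝔔, h𝔔p, h𝔔⟩ := exists_isPrime_comap_absIntegersMap_eq (F := ℚ) (M := K) 𝔓
  haveI := h𝔔p
  have h𝔔v : 𝔔.comap (absIntegersMap ℚ K) ∈ v.primesAbove := by rw [h𝔔]; exact h𝔓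
  obtain ⟨w, hwv, h𝔔w, -⟩ := exists_heightOneSpectrum_of_comap_absIntegersMap_mem_primesAbove h𝔔v
  have hℓw : (ℓ : 𝓞 K) ∈ w.asIdeal := by
    have h : (ℓ : 𝓞 ℚ) ∈ w.asIdeal.under (𝓞 ℚ) := by rw [hwv]; exact hℓv
    rw [Ideal.under_def, Ideal.mem_comap, map_natCast] at h
    exact h
  -- `τ ∈ D_𝔔` (transport of `F·F ∈ D_𝔓`)
  have hτD : τ ∈ 𝔔.decompositionSubgroup (absoluteGaloisGroup K) := by
    rw [← comap_decompositionSubgroup_comap_absIntegersMap ℚ K 𝔔, Subgroup.mem_comap]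
    change absGaloisRestrict ℚ K τ ∈ _
    rw [hτF, h𝔔]
    exact Subgroup.mul_mem _ hF.mem_stabilizer hF.mem_stabilizer
  -- a `K`-embedding of `K[ℓ]` into `K̄`, fixed by `τ` (§4)
  haveI := (finiteDimensional_and_isGalois_ringClassField hK ι hℓ0).1
  let ιE : ringClassField K ι ℓ →ₐ[K] AlgebraicClosure K := IsAlgClosed.lift
  have hτE : ∀ e : ringClassField K ι ℓ, τ • ιE e = ιE e := fun e ↦
    smul_algHom_ringClassField_eq_of_absGaloisRestrict_eq_sq hK hℓp hinert hℓv h𝔓 hF ι ιE hτF e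
  exact h1Eval_kolyvaginClass_eq_zero_of_fixes_ringClassField W hK hD Dt β ι k hc hcK d hℓ hkℓ w hℓw h𝔔w ιE hτD
    hτT hτE

end KSide

section Socket

variable {K : Type} [Field K] [NumberField K] (W : WeierstrassCurve ℚ) [W.IsElliptic] [W.IsGloballyMinimal]
  [NeZero (W.conductorNorm ℤ)]

/-- **§2 THE (V44)-SOCKET `hTr` OF THE BOTTOM RUNG, PROVED** (VERBATIM the hypothesis `hTr` of `RelaxedCount.hbot_socket_margin` /
`exists_deep_primitive_of_gross_witness_pow_frobEq`, for every `L ≥ 3`).  On `Δ < 0`, `K` imaginary quadratic with `d_K` odd `≠ −3`: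
for a ℚ-class `Z` over `E[4]` descending the level-`4` Kolyvagin class `c₂(n′)` of a square-free product `n′` of Zhang–Kolyvagin primes of
index `≥ 2`, an own prime `ℓ ∣ n′` of index `≥ L ≥ 3`, and an arithmetic Frobenius `F` above `ℓ` acting on `E[4]` as a complex conjugation
`c₀`: `[2•Z, F] = F•P₁ − P₁` for some `P₁`.  (The level-`2^L` Frobenius condition is not used.)
[cite: McCallumLMS1991, §4 Prop. 4.4 (1), §5 proof of Prop. 5.2 (13)] [cite: Howard2004HeegnerKolyvagin, Lemma 2.7.3] [cite: GrossLMS1991, §9] -/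
theorem hTr_of_three_le (hK : IsImaginaryQuadratic K) (hodd : Odd (NumberField.discr K)) (h3 : NumberField.discr K ≠ -3)
    (hΔ : W.Δ < 0) (Dt : ModularParametrizationData W (W.conductorNorm ℤ)) (β : ℤ) (ι : K →+* ℂ)
    [∀ j : ℕ, NumberField (ringClassField K ι j)] {L : ℕ} (hL : 3 ≤ L) :
    ∀ (n' : ℕ) (d' : KolyvaginHeegnerData Dt β ι n') (Z : galoisCohomology (W.torsionGaloisModule ((2 ^ 2 : ℕ) : ℤ)) 1),
      Squarefree n' →
      (∀ q ∈ n'.primeFactors, Zhang2014.IsKolyvaginPrime (W.conductorNorm ℤ) W K 2 q ∧ 2 ≤ Zhang2014.kolyvaginIndex W 2 q ∧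
        FrobEqFrobInfty W K (2 ^ 2) q) →
      resTorsion W K ((2 ^ 2 : ℕ) : ℤ) Z = d'.kolyvaginClass Nat.prime_two 2 →
      ∀ (v : HeightOneSpectrum (𝓞 ℚ)) (ℓ : ℕ), ℓ ∈ n'.primeFactors → (ℓ : 𝓞 ℚ) ∈ v.asIdeal →
        L ≤ Zhang2014.kolyvaginIndex W 2 ℓ → FrobEqFrobInfty W K (2 ^ L) ℓ →
        ∀ 𝔓 ∈ v.primesAbove, ∀ F c₀ : absoluteGaloisGroup ℚ, IsArithFrobAt (𝓞 ℚ) F 𝔓 →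
          IsComplexConjugation (Rat.castHom ℝ) c₀ → (∀ P : geomTorsion W ((2 ^ 2 : ℕ) : ℤ), F • P = c₀ • P) →
          ∃ P₁ : geomTorsion W ((2 ^ 2 : ℕ) : ℤ), h1Eval W _ ((2 : ℕ) • Z) F = F • P₁ - P₁ := by
  intro n' d' Z hn' hn'K hZ v ℓ hℓ hℓv hLℓ _ 𝔓 h𝔓 F c₀ hF hc₀ hFc₀
  have h2K : Module.finrank ℚ K = 2 := hK.1
  have hD : NumberField.discr K < -4 := IsImaginaryQuadratic.discr_lt_neg_four_of_odd hK hodd h3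
  -- the regular frame of `c₀` on `E[4]` (`Δ < 0`)
  obtain ⟨P₀, -, hgen, hfree⟩ := FrobeniusCriterion.exists_regular_generator_of_Δ_neg W hΔ hc₀ (M := 2) (by norm_num)
  have hc₀c₀ : ∀ P : geomTorsion W ((2 ^ 2 : ℕ) : ℤ), c₀ • c₀ • P = P := fun P ↦ by
    rw [← mul_smul, ← pow_two, hc₀.sq_eq_one, one_smul]
  have hfree4 : ∀ a b : ℤ, a • P₀ + b • c₀ • P₀ = 0 → (4 : ℤ) ∣ a ∧ (4 : ℤ) ∣ b := fun a b h ↦ by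
    have h' := hfree a b h
    norm_num at h'
    exact h'
  have hFF : ∀ Q : geomTorsion W ((2 ^ 2 : ℕ) : ℤ), F • F • Q = Q := fun Q ↦ by rw [hFc₀, hFc₀, hc₀c₀]
  refine RelaxedCount.exists_h1Eval_two_nsmul_eq_smul_sub_of_sq hFc₀ hc₀c₀ hgen hfree4 Z ?_
  -- `τ ∈ Γ_K` over `F·F`, fixing `E_K[4]`
  obtain ⟨θ, hθQ, hθ⟩ := exists_sq_eq_discr_not_mem_range K h2K
  have hθ' : θ ∉ (algebraMap ℚ K).range := fun h ↦ hθQ (RingHom.mem_range.mp h)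
  obtain ⟨τ, hτF⟩ := SelmerDescent.sq_mem_range_absGaloisRestrict_of_sq_eq h2K hθ' hθ F
  have hτF' : absGaloisRestrict ℚ K τ = F * F := hτF
  have hτF'' : resGal (K := ℚ) K τ = F * F := hτF
  have hτT : τ ∈ torsionFixing (W.baseChange K) ((2 ^ 2 : ℕ) : ℤ) := by
    rw [mem_torsionFixing_iff]
    intro Q
    obtain ⟨P, rfl⟩ := (torsionBaseChangeMap_bijective K W ((2 ^ 2 : ℕ) : ℤ)).2 Q
    rw [← torsionBaseChangeMap_smul, hτF'', mul_smul, hFF]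
  refine RelaxedCount.two_zsmul_h1Eval_sq_eq_zero_of_resTorsion Z hτF'' hτT ?_
  rw [hZ, h1Eval_kolyvaginClass_eq_zero_of_absGaloisRestrict_eq_sq W hK hD Dt β ι 2 hn'
    (fun q hq ↦ ⟨(hn'K q hq).1, (hn'K q hq).2.1⟩) d' hℓ (by omega) hℓv h𝔓 hF hτF' hτT, smul_zero]

/-- **§3 THE BOTTOM-RUNG CLOSURE WITH `hTr` DISCHARGED**: LEAD's `RelaxedCount.exists_deep_primitive_of_gross_witness'` (all-deep primitive
product from a level-`4` Gross witness, either parity) for every `L ≥ 3`, modulo (NPh_L^{2N}) and Q2 only.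
[cite: McCallumLMS1991, §5 proof of Prop. 5.2, p. 285] [cite: Kolyvagin1991MathAnn, Thm. 2.2] [cite: Howard2004HeegnerKolyvagin, Lemma 2.7.3] -/
theorem exists_deep_primitive_of_gross_witness_of_three_le (hQ2 : KolyvaginRelationAtTwo) (hcm : ¬ W.HasCM) (hΔ : W.Δ < 0)
    (hT : Odd W.tamagawaProduct) (hρ : ∀ m : ℕ, W.HasSurjectiveModNGaloisRep (2 ^ m : ℕ))
    (hK : IsImaginaryQuadratic K) (hodd : Odd (NumberField.discr K)) (h3 : NumberField.discr K ≠ -3)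
    (hHe : SatisfiesHeegnerHypothesis (W.conductorNorm ℤ) K) (hns : ¬ IsSquare ((NumberField.discr K : ℚ) * -|W.Δ|))
    (Dt : ModularParametrizationData W (W.conductorNorm ℤ)) (β : ℤ) (ι : K →+* ℂ)
    [∀ j : ℕ, NumberField (ringClassField K ι j)] {L : ℕ} (hL3 : 3 ≤ L)
    (hNPh : ∀ z : galH1Torsion (W.baseChange K) ((2 ^ L : ℕ) : ℤ),
      (∀ ρ' ∈ torsionFixing (W.baseChange K) ((2 ^ L : ℕ) : ℤ), h1Eval (W.baseChange K) ((2 ^ L : ℕ) : ℤ) z ρ' = 0) →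
      (∀ w : HeightOneSpectrum (𝓞 K), ((2 * W.conductorNorm ℤ : ℕ) : 𝓞 K) ∈ w.asIdeal →
        z ∈ selmerLocalKer (W.baseChange K) (w.adicCompletion K) ((2 ^ L : ℕ) : ℤ)) → z = 0)
    {n₀ : ℕ} (hn₀ : Squarefree n₀)
    (hn₀K : ∀ q ∈ n₀.primeFactors, Zhang2014.IsKolyvaginPrime (W.conductorNorm ℤ) W K 2 q ∧ 2 ≤ Zhang2014.kolyvaginIndex W 2 q ∧
      FrobEqFrobInfty W K (2 ^ 2) q)
    (e₀ : KolyvaginHeegnerData Dt β ι n₀) (he₀ : addOrderOf (e₀.kolyvaginClass Nat.prime_two 2) = 2 ^ 2) :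
    ∃ (n : ℕ) (e : KolyvaginHeegnerData Dt β ι n), Squarefree n ∧
      (n.primeFactors.card = n₀.primeFactors.card ∨ n.primeFactors.card = n₀.primeFactors.card + 1) ∧
      (∀ q ∈ n.primeFactors, Zhang2014.IsKolyvaginPrime (W.conductorNorm ℤ) W K 2 q ∧ L ≤ Zhang2014.kolyvaginIndex W 2 q ∧
        FrobEqFrobInfty W K (2 ^ L) q) ∧
      addOrderOf (e.kolyvaginClass Nat.prime_two 2) = 2 ^ 2 :=
  RelaxedCount.exists_deep_primitive_of_gross_witness' W hQ2 hcm hΔ hT hρ hK hodd h3 hHe hns Dt β ι (by omega) hNPh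
    (hTr_of_three_le W hK hodd h3 hΔ Dt β ι hL3) hn₀ hn₀K e₀ he₀

/-- **§3 THE SOCKET `hbot` OF THE KS ASSEMBLY, margin-`k` class, WITH `hTr` DISCHARGED**: gk2-p5 g24's `RelaxedCount.hbot_socket_margin`
composed with `hTr_of_three_le` at level parameter `L + k` (so `3 ≤ L + k` is asked — free for the KS assembly, `L ≥ 12`).  Displayed
residuals: Q2 `KolyvaginRelationAtTwo` and (NPh_{L+k}^{2N}) only. [cite: McCallumLMS1991, §5 proof of Prop. 5.2, p. 285]
[cite: Kolyvagin1991MathAnn, Thm. 2.2] [cite: Howard2004HeegnerKolyvagin, Lemma 2.7.3] -/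
theorem hbot_socket_margin_of_three_le (hQ2 : KolyvaginRelationAtTwo) (hcm : ¬ W.HasCM) (hΔ : W.Δ < 0)
    (hT : Odd W.tamagawaProduct) (hρ : ∀ m : ℕ, W.HasSurjectiveModNGaloisRep (2 ^ m : ℕ))
    (hK : IsImaginaryQuadratic K) (hodd : Odd (NumberField.discr K)) (h3 : NumberField.discr K ≠ -3)
    (hHe : SatisfiesHeegnerHypothesis (W.conductorNorm ℤ) K) (hns : ¬ IsSquare ((NumberField.discr K : ℚ) * -|W.Δ|))
    (Dt : ModularParametrizationData W (W.conductorNorm ℤ)) (β : ℤ) (ι : K →+* ℂ)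
    [∀ j : ℕ, NumberField (ringClassField K ι j)] {L : ℕ} (hL2 : 2 ≤ L) (k : ℕ) (hLk : 3 ≤ L + k)
    (hNPh : ∀ z : galH1Torsion (W.baseChange K) ((2 ^ (L + k) : ℕ) : ℤ),
      (∀ ρ' ∈ torsionFixing (W.baseChange K) ((2 ^ (L + k) : ℕ) : ℤ), h1Eval (W.baseChange K) ((2 ^ (L + k) : ℕ) : ℤ) z ρ' = 0) →
      (∀ w : HeightOneSpectrum (𝓞 K), ((2 * W.conductorNorm ℤ : ℕ) : 𝓞 K) ∈ w.asIdeal →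
        z ∈ selmerLocalKer (W.baseChange K) (w.adicCompletion K) ((2 ^ (L + k) : ℕ) : ℤ)) → z = 0)
    (G : ℕ → Prop)
    (hG : ∀ q : ℕ, Zhang2014.IsKolyvaginPrime (W.conductorNorm ℤ) W K 2 q → L + k ≤ Zhang2014.kolyvaginIndex W 2 q →
      FrobEqFrobInfty W K (2 ^ (L + k)) q → G q)
    {n₀ : ℕ} (hn₀ : Squarefree n₀)
    (hn₀K : ∀ q ∈ n₀.primeFactors, Zhang2014.IsKolyvaginPrime (W.conductorNorm ℤ) W K 2 q ∧ 2 ≤ Zhang2014.kolyvaginIndex W 2 q ∧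
      FrobEqFrobInfty W K (2 ^ 2) q)
    (e₀ : KolyvaginHeegnerData Dt β ι n₀) (he₀ : addOrderOf (e₀.kolyvaginClass Nat.prime_two 2) = 2 ^ 2) :
    ∃ (n : ℕ) (d : KolyvaginHeegnerData Dt β ι n), Squarefree n ∧
      (∀ q ∈ n.primeFactors, (Zhang2014.IsKolyvaginPrime (W.conductorNorm ℤ) W K 2 q ∧ L ≤ Zhang2014.kolyvaginIndex W 2 q) ∧ G q) ∧
      addOrderOf (d.kolyvaginClass Nat.prime_two L) = 2 ^ L :=
  RelaxedCount.hbot_socket_margin W hQ2 hcm hΔ hT hρ hK hodd h3 hHe hns Dt β ι hL2 k hNPh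
    (hTr_of_three_le W hK hodd h3 hΔ Dt β ι hLk) G hG hn₀ hn₀K e₀ he₀

/-- **§3 THE SOCKET `hbot`, margin-`k` class, ON THE CUT HABITAT, WITH `hTr` DISCHARGED**: gk2-p5 g24's
`RelaxedCount.hbot_socket_margin_onHabitat` («∃ odd place `v ∣ N` of multiplicative reduction», (NPh) discharged by
`nonPhantomAtTwo_of_hasMultiplicativeReductionAt`, witness `P(n₀) ∉ 2E(K[n₀])`, level-2 Gross primes of index `≥ 2`) composed with
`hTr_of_three_le`.  Displayed residual: Q2 only. [cite: McCallumLMS1991, §5 Prop. 5.2 and its proof, p. 285] [cite: GrossLMS1991, §3 (3.3)] -/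
theorem hbot_socket_margin_onHabitat_of_three_le (hQ2 : KolyvaginRelationAtTwo) (hcm : ¬ W.HasCM) (hΔ : W.Δ < 0)
    (hT : Odd W.tamagawaProduct) (hρ : ∀ m : ℕ, W.HasSurjectiveModNGaloisRep (2 ^ m : ℕ))
    (hK : IsImaginaryQuadratic K) (hodd : Odd (NumberField.discr K)) (h3 : NumberField.discr K ≠ -3)
    (hHe : SatisfiesHeegnerHypothesis (W.conductorNorm ℤ) K) (hns : ¬ IsSquare ((NumberField.discr K : ℚ) * -|W.Δ|))
    (hns₂ : ¬ IsSquare ((NumberField.discr K : ℚ) * (-(2 * |W.Δ|))))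
    {v : HeightOneSpectrum (𝓞 ℚ)} (h2v : ((2 : ℕ) : 𝓞 ℚ) ∉ v.asIdeal) (hNv : ((W.conductorNorm ℤ : ℕ) : 𝓞 ℚ) ∈ v.asIdeal)
    (hmult : W.HasMultiplicativeReductionAt v)
    (Dt : ModularParametrizationData W (W.conductorNorm ℤ)) (β : ℤ) (ι : K →+* ℂ)
    [∀ j : ℕ, NumberField (ringClassField K ι j)] {L : ℕ} (hL2 : 2 ≤ L) (k : ℕ) (hLk : 3 ≤ L + k)
    (G : ℕ → Prop)
    (hG : ∀ q : ℕ, Zhang2014.IsKolyvaginPrime (W.conductorNorm ℤ) W K 2 q → L + k ≤ Zhang2014.kolyvaginIndex W 2 q →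
      FrobEqFrobInfty W K (2 ^ (L + k)) q → G q)
    {n₀ : ℕ} (hn₀ : Squarefree n₀)
    (hn₀K : ∀ q ∈ n₀.primeFactors, Zhang2014.IsKolyvaginPrime (W.conductorNorm ℤ) W K 2 q ∧ 2 ≤ Zhang2014.kolyvaginIndex W 2 q ∧
      FrobEqFrobInfty W K 2 q)
    (e₀ : KolyvaginHeegnerData Dt β ι n₀)
    (he₀ : ¬ ∃ Q : (W.baseChange (ringClassField K ι n₀)).toAffine.Point, (2 : ℤ) • Q = e₀.derivedPoint) :
    ∃ (n : ℕ) (d : KolyvaginHeegnerData Dt β ι n), Squarefree n ∧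
      (∀ q ∈ n.primeFactors, (Zhang2014.IsKolyvaginPrime (W.conductorNorm ℤ) W K 2 q ∧ L ≤ Zhang2014.kolyvaginIndex W 2 q) ∧ G q) ∧
      addOrderOf (d.kolyvaginClass Nat.prime_two L) = 2 ^ L :=
  RelaxedCount.hbot_socket_margin_onHabitat W hQ2 hcm hΔ hT hρ hK hodd h3 hHe hns hns₂ h2v hNv hmult Dt β ι hL2 k
    (hTr_of_three_le W hK hodd h3 hΔ Dt β ι hLk) G hG hn₀ hn₀K e₀ he₀

end Socket

end Summit.BirchSwinnertonDyer.BirchSwinnertonDyer.Theorems.GenusExact.TransverseValue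

end
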